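import Mathlib
import Literature.Analysis.PDE.Wave1DSourceEnergy
import HarnessLib

/-!
# Flux bookkeeping for `ψ_tt − ψ_xx + V(x)ψ = F`: localised monotonicity and infinite-energy channels

Analysis/PDE support file (everything proved). Two consequences of the trapezoid energy identities
(`Wave1DTrapezoidEnergy.lean`, `Wave1DSourceEnergy.lean`) used by the near-horizon channel estimate
of route PhotonSphereChannels (`FixedModeChannels`, stmt-FinalStateConjecture-10048):

* `wave1D_trapezoid_energy_mono_of_source_eq_zero` — for the SOURCED equation, if the source
  vanishes on the trapezoid then the energy on its top is at most the energy on its base (`V ≥ 0`):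
  this is how a function that solves the homogeneous equation only on a half-space `{x < A}` (e.g.
  `ψ − β u` with `u` a static solution on `{x < A}` extended arbitrarily) is handled by the global
  machinery;
* `wave1D_truncated_energy_ge` — INFINITE-ENERGY BOOKKEEPING for the homogeneous equation: the energy
  at time `t ≥ 0` on `[b + t, a − t]` is at least the initial energy on `[b + 2t, a]` minus the flux
  through the right edge `x = a − τ` (a quantity independent of `b`): the flux leaving through the
  left edge `x = b + τ` is fed only by the data on `[b, b + 2t]`. Hence
  `wave1D_nearEnergy_eq_top_of_initial_eq_top`: if the initial energy on `(−∞, a)` is infinite, the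
  energy to the left of `a − |t|` is infinite for every `t` (both time directions), so two-sided
  channel inequalities hold trivially for infinite-energy data.

Folklore (domain of dependence), cf. L. C. Evans, *Partial Differential Equations*, §2.4.3.
-/

noncomputable section

namespace Literature.Analysis.PDE

open MeasureTheory Set Filter Topology intervalIntegral Literature.Analysis.Calculus

variable {V : ℝ → ℝ} {F ψ : ℝ → ℝ → ℝ}

/-- **Localised energy monotonicity.** For a `C²` solution of `ψ_tt − ψ_xx + V(x)ψ = F` (`V ≥ 0`,
`V`, `F` continuous) whose source vanishes on the closed trapezoid `{s ≤ τ ≤ t, a + τ ≤ x ≤ b − τ}`,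
the energy on the top is at most the energy on the base. [folklore] -/
theorem wave1D_trapezoid_energy_mono_of_source_eq_zero (hV : Continuous V) (hV0 : ∀ x, 0 ≤ V x)
    (hF : Continuous (Function.uncurry F)) (hψ : ContDiff ℝ 2 (Function.uncurry ψ))
    (hsol : ∀ t x, iteratedDeriv 2 (fun τ => ψ τ x) t - iteratedDeriv 2 (ψ t) x + V x * ψ t x
      = F t x)
    {a b s t : ℝ} (hst : s ≤ t) (hab : a + t ≤ b - t)
    (hF0 : ∀ τ ∈ Icc s t, ∀ x ∈ Icc (a + τ) (b - τ), F τ x = 0) :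
    (∫ x in (a + t)..(b - t),
        (deriv (fun τ => ψ τ x) t ^ 2 + deriv (ψ t) x ^ 2 + V x * ψ t x ^ 2))
      ≤ ∫ x in (a + s)..(b - s),
        (deriv (fun τ => ψ τ x) s ^ 2 + deriv (ψ s) x ^ 2 + V x * ψ s x ^ 2) := by
  have h := wave1D_trapezoid_energy_sub_le_source hV hV0 hF hψ hsol hst hab
  have hzero : (∫ τ in s..t, ∫ x in (a + τ)..(b - τ), deriv (fun σ => ψ σ x) τ * F τ x) = 0 := by
    rw [← intervalIntegral.integral_zero (a := s) (b := t)]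
    refine integral_congr fun τ hτ => ?_
    rw [uIcc_of_le hst] at hτ
    have hle : a + τ ≤ b - τ := by linarith [hτ.2]
    rw [← intervalIntegral.integral_zero (a := a + τ) (b := b - τ)]
    refine integral_congr fun x hx => ?_
    rw [uIcc_of_le hle] at hx
    simp [hF0 τ hτ x hx]
  rw [hzero, mul_zero] at h
  linarith

section Homogeneous

/-- **Infinite-energy bookkeeping (interval form).** For a `C²` solution of the homogeneous equation
`ψ_tt − ψ_xx + V(x)ψ = 0` (`V ≥ 0` continuous), `0 ≤ t` and `b + 2t ≤ a`: the energy at time `t` on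
`[b + t, a − t]` is at least the initial energy on `[b + 2t, a]` minus the flux through the right
characteristic edge `x = a − τ`, `0 ≤ τ ≤ t` (which does not depend on `b`) — the flux leaving
through the left edge `x = b + τ` is at most the initial energy on `[b, b + 2t]` (triangle identity).
[folklore] -/
theorem wave1D_truncated_energy_ge (hV : Continuous V) (hV0 : ∀ x, 0 ≤ V x)
    (hψ : ContDiff ℝ 2 (Function.uncurry ψ))
    (hsol : ∀ t x, iteratedDeriv 2 (fun τ => ψ τ x) t - iteratedDeriv 2 (ψ t) x + V x * ψ t x = 0)
    {a b t : ℝ} (ht : 0 ≤ t) (hab : b + 2 * t ≤ a) :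
    (∫ x in (b + 2 * t)..a,
        (deriv (fun τ => ψ τ x) 0 ^ 2 + deriv (ψ 0) x ^ 2 + V x * ψ 0 x ^ 2))
      - ∫ x in (a - t)..a, ((deriv (fun τ => ψ τ x) (a - x) - deriv (ψ (a - x)) x) ^ 2
          + V x * ψ (a - x) x ^ 2)
      ≤ ∫ x in (b + t)..(a - t),
        (deriv (fun τ => ψ τ x) t ^ 2 + deriv (ψ t) x ^ 2 + V x * ψ t x ^ 2) := by
  -- trapezoid on the base `[b, a]`
  have hT := wave1D_trapezoid_energy_identity hV hψ hsol (a := b) (b := a) (s := 0) ht (by linarith)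
  -- triangle on the base `[b, b + 2t]` (top of zero length)
  have hΔ := wave1D_trapezoid_energy_identity hV hψ hsol (a := b) (b := b + 2 * t) (s := 0) ht
    (by linarith)
  simp only [add_zero, sub_zero] at hT hΔ
  have htopΔ : (∫ x in (b + t)..(b + 2 * t - t),
      (deriv (fun τ => ψ τ x) t ^ 2 + deriv (ψ t) x ^ 2 + V x * ψ t x ^ 2)) = 0 := by
    rw [show b + 2 * t - t = b + t by ring, intervalIntegral.integral_same]
  rw [htopΔ] at hΔ
  -- the right flux of the triangle is signed
  have hRΔ : 0 ≤ ∫ x in (b + 2 * t - t)..(b + 2 * t),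
      ((deriv (fun τ => ψ τ x) (b + 2 * t - x) - deriv (ψ (b + 2 * t - x)) x) ^ 2
        + V x * ψ (b + 2 * t - x) x ^ 2) :=
    intervalIntegral.integral_nonneg (by linarith) fun x _ => by
      have := hV0 x; positivity
  -- split the initial energy on `[b, a]` at `b + 2t`
  have hc : Continuous fun x =>
      deriv (fun τ => ψ τ x) 0 ^ 2 + deriv (ψ 0) x ^ 2 + V x * ψ 0 x ^ 2 :=
    (continuous_wave1D_energyDensity hV hψ).comp (continuous_const.prodMk continuous_id)
  have hsplit : (∫ x in b..a, (deriv (fun τ => ψ τ x) 0 ^ 2 + deriv (ψ 0) x ^ 2 + V x * ψ 0 x ^ 2))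
      = (∫ x in b..(b + 2 * t), (deriv (fun τ => ψ τ x) 0 ^ 2 + deriv (ψ 0) x ^ 2 + V x * ψ 0 x ^ 2))
        + ∫ x in (b + 2 * t)..a,
          (deriv (fun τ => ψ τ x) 0 ^ 2 + deriv (ψ 0) x ^ 2 + V x * ψ 0 x ^ 2) :=
    (integral_add_adjacent_intervals (hc.intervalIntegrable _ _) (hc.intervalIntegrable _ _)).symm
  linarith

/-- **Infinite initial energy forces infinite left-channel energy, forward in time.** For a `C²`
solution of `ψ_tt − ψ_xx + V(x)ψ = 0` (`V ≥ 0` continuous): if `∫⁻_{x < a} e(0,·) = ∞` then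
`∫⁻_{x < a − t} e(t,·) = ∞` for every `t ≥ 0`. [folklore] -/
theorem wave1D_lintegral_Iio_energy_eq_top_of_nonneg (hV : Continuous V) (hV0 : ∀ x, 0 ≤ V x)
    (hψ : ContDiff ℝ 2 (Function.uncurry ψ))
    (hsol : ∀ t x, iteratedDeriv 2 (fun τ => ψ τ x) t - iteratedDeriv 2 (ψ t) x + V x * ψ t x = 0)
    {a : ℝ} (htop : ∫⁻ x in Iio a, ENNReal.ofReal
        (deriv (fun τ => ψ τ x) 0 ^ 2 + deriv (ψ 0) x ^ 2 + V x * ψ 0 x ^ 2) = ⊤)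
    {t : ℝ} (ht : 0 ≤ t) :
    ∫⁻ x in Iio (a - t), ENNReal.ofReal
        (deriv (fun τ => ψ τ x) t ^ 2 + deriv (ψ t) x ^ 2 + V x * ψ t x ^ 2) = ⊤ := by
  -- the initial energy on `(b + 2t, a]` tends to `∞` as `b → −∞`
  set e0 : ℝ → ℝ := fun x => deriv (fun τ => ψ τ x) 0 ^ 2 + deriv (ψ 0) x ^ 2 + V x * ψ 0 x ^ 2
    with he0
  set et : ℝ → ℝ := fun x => deriv (fun τ => ψ τ x) t ^ 2 + deriv (ψ t) x ^ 2 + V x * ψ t x ^ 2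
    with het
  set R : ℝ := ∫ x in (a - t)..a, ((deriv (fun τ => ψ τ x) (a - x) - deriv (ψ (a - x)) x) ^ 2
    + V x * ψ (a - x) x ^ 2) with hR
  have he0_nn : ∀ x, 0 ≤ e0 x := fun x => wave1D_energyDensity_nonneg hV0 0 x
  have het_nn : ∀ x, 0 ≤ et x := fun x => wave1D_energyDensity_nonneg hV0 t x
  -- `Iio a` exhausted by `Ioc (a - n) a` up to the null set `{a}`: lintegral of `e0` is the sup
  have hunion : Iic a = ⋃ n : ℕ, Ioc (a - n) a := by
    ext x
    simp only [mem_iUnion, mem_Ioc, mem_Iic]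
    constructor
    · intro h
      obtain ⟨n, hn⟩ := exists_nat_gt (a - x)
      exact ⟨n, by linarith, h⟩
    · rintro ⟨n, _, h2⟩; exact h2
  have hdir : Directed (· ⊆ ·) fun n : ℕ => Ioc (a - n) a :=
    Monotone.directed_le fun m n hmn => Ioc_subset_Ioc (by
      have : (m : ℝ) ≤ n := by exact_mod_cast hmn
      linarith) le_rfl
  have htop' : (⨆ n : ℕ, ∫⁻ x in Ioc (a - n) a, ENNReal.ofReal (e0 x)) = ⊤ := by
    rw [← setLIntegral_iUnion_of_directed _ hdir, ← hunion,
      ← setLIntegral_congr (Iio_ae_eq_Iic (μ := volume) (a := a))]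
    exact htop
  -- so the truncated initial energies are unbounded
  have hI : ∀ K : ℝ, 0 ≤ K → ∃ n : ℕ, K < ∫ x in (a - n)..a, e0 x := by
    intro K hK
    have hlt : ENNReal.ofReal K < ⨆ n : ℕ, ∫⁻ x in Ioc (a - n) a, ENNReal.ofReal (e0 x) := by
      rw [htop']; exact ENNReal.ofReal_lt_top
    obtain ⟨n, hn⟩ := lt_iSup_iff.1 hlt
    refine ⟨n, ?_⟩
    have hn0 : (0 : ℝ) ≤ n := n.cast_nonneg
    rw [lintegral_Ioc_wave1D_energy_eq hV hV0 hψ 0 (by linarith)] at hn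
    exact (ENNReal.ofReal_lt_ofReal_iff_of_nonneg hK).1 hn
  -- conclude: the left energy at time `t` exceeds every real number
  refine ENNReal.eq_top_of_forall_nnreal_le fun K => ?_
  have hR0 : 0 ≤ R := intervalIntegral.integral_nonneg (by linarith) fun x _ => by
    have := hV0 x; positivity
  obtain ⟨n, hn⟩ := hI (K + R) (by positivity)
  have hn0 : (0 : ℝ) ≤ n := n.cast_nonneg
  -- truncated energy estimate with `b = a - n - 2t`
  have hge := wave1D_truncated_energy_ge hV hV0 hψ hsol (a := a) (b := a - n - 2 * t) ht (by linarith)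
  have hb1 : a - n - 2 * t + 2 * t = a - n := by ring
  have hb2 : a - n - 2 * t + t = a - n - t := by ring
  rw [hb1, hb2] at hge
  calc ((K : NNReal) : ENNReal) = ENNReal.ofReal K := (ENNReal.ofReal_coe_nnreal).symm
    _ ≤ ENNReal.ofReal (∫ x in (a - n - t)..(a - t), et x) := by
        refine ENNReal.ofReal_le_ofReal ?_
        have : (K : ℝ) + R < (∫ x in (a - n)..a, e0 x) := hn
        simp only [he0, het] at this hge ⊢
        linarith
    _ = ∫⁻ x in Ioc (a - n - t) (a - t), ENNReal.ofReal (et x) :=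
        (lintegral_Ioc_wave1D_energy_eq hV hV0 hψ t (by linarith)).symm
    _ ≤ ∫⁻ x in Iio (a - t), ENNReal.ofReal (et x) := by
        rw [setLIntegral_congr (Iio_ae_eq_Iic (μ := volume) (a := a - t))]
        exact lintegral_mono_set Ioc_subset_Iic_self

/-- **Infinite initial energy forces infinite left-channel energy, both time directions**: if
`∫⁻_{x < a} e(0,·) = ∞` then `∫⁻_{x < a − |t|} e(t,·) = ∞` for every `t`. [folklore] -/
theorem wave1D_nearEnergy_eq_top_of_initial_eq_top (hV : Continuous V) (hV0 : ∀ x, 0 ≤ V x)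
    (hψ : ContDiff ℝ 2 (Function.uncurry ψ))
    (hsol : ∀ t x, iteratedDeriv 2 (fun τ => ψ τ x) t - iteratedDeriv 2 (ψ t) x + V x * ψ t x = 0)
    {a : ℝ} (htop : ∫⁻ x in Iio a, ENNReal.ofReal
        (deriv (fun τ => ψ τ x) 0 ^ 2 + deriv (ψ 0) x ^ 2 + V x * ψ 0 x ^ 2) = ⊤) (t : ℝ) :
    ∫⁻ x in Iio (a - |t|), ENNReal.ofReal
        (deriv (fun τ => ψ τ x) t ^ 2 + deriv (ψ t) x ^ 2 + V x * ψ t x ^ 2) = ⊤ := by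
  rcases le_total 0 t with ht | ht
  · rw [abs_of_nonneg ht]
    exact wave1D_lintegral_Iio_energy_eq_top_of_nonneg hV hV0 hψ hsol htop ht
  · obtain ⟨hψ', hsol', he'⟩ := wave1D_timeReversal hψ hsol
    have htop' : ∫⁻ x in Iio a, ENNReal.ofReal (deriv (fun τ => (fun t x => ψ (-t) x) τ x) 0 ^ 2
        + deriv ((fun t x => ψ (-t) x) 0) x ^ 2 + V x * (fun t x => ψ (-t) x) 0 x ^ 2) = ⊤ := by
      simp only [he', neg_zero]
      exact htop
    have h := wave1D_lintegral_Iio_energy_eq_top_of_nonneg hV hV0 hψ' hsol' htop' (t := -t)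
      (by linarith)
    simp only [he', neg_neg] at h
    rw [abs_of_nonpos ht]
    exact h

end Homogeneous

end Literature.Analysis.PDE
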